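import Summits.HodgeConjecture.HodgeConjecture.Theorems.HeckePrymWeilWeilSixfoldsSqrtMinus7WeilSignatureEigenLine
import Literature.AlgebraicGeometry.HodgeTheory.WeilClassesHodgeType
import Literature.AlgebraicGeometry.HodgeTheory.HodgeTypeVanishing
import Literature.AlgebraicGeometry.HodgeTheory.HodgeTypeConjugation
import Literature.AlgebraicGeometry.HodgeTheory.HodgeTypeExteriorProduct
import Literature.AlgebraicGeometry.HodgeTheory.ComplexGysinHodgeType
import HarnessLib

/-!
# Crux `WeilSixfoldsSqrtMinus7` (stmt-HodgeConjecture-1260), line `hyperbolic-eightfold-descent` — the Weil typing: multiplicities `(n, n)` from the Weil witness (G3, part 2)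

Route `HeckePrymWeil`, sub-goal G3 (`stub_weilSignature`) of Stub 7 (aimed partner at `d = 7`).
**`weilTyping`**: for a complex abelian `2n`-fold `(A, φ)` with `φ ≫ φ = -7` (`n ≥ 1`) carrying a
non-zero rational `(n,n)`-class in its Weil span
`Eig((𝟙+φ)^*, (1+i√7)^{2n}) ⊔ Eig((𝟙+φ)^*, (1-i√7)^{2n})` (the crux's typing by ONE operator), there
are `n`-dimensional subspaces `T₊ ⊆ V₊ ∩ H^{1,0}`, `T₋ ⊆ V₋ ∩ H^{1,0}` (`V± = ker(φ^* ∓ i√7)` on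
`H¹(A(ℂ); ℂ)`): `K = ℚ(√-7)` acts on `H^{1,0}` with multiplicities `(n, n)` — van Geemen's
Definition 4.9 of Weil type recovered from the witness (Deligne–Milne LNM 900 Prop. 4.4, "only
if"; the tree's `finrank_eq_of_mem_weilClassesOf` is the same statement for the Weil plane of ALL
test endomorphisms). Proof: `φ^*` preserves Hodge types, so `V_μ = (V_μ ∩ H^{1,0}) ⊕ (V_μ ∩ H^{0,1})`
(projectors `(φ^* + μ)/(2μ)`), of dimensions `(a_μ, b_μ)`, `a_μ + b_μ = 2n`; a typed eigenbasis
`e_μ` of `V_μ` gives the Weil line `Eig((𝟙+φ)^*, (1 + μ)^{2n}) = ℂ · ∪ e_μ` (part 1,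
`eigenspace_one_add_eq_span_cupPowOne`) of Hodge type `(a_μ, b_μ)` (`isOfHodgeType_cupPowOne`);
the components `c±` of the rational witness are conjugate (`c₋ = conj c₊`, `conjClass_mem_eigenspace_map`,
the two typed eigenvalues being distinct, `one_add_I_sqrt7_pow_ne`) and non-zero, so a non-zero
`(n,n)` sum forces `(a₊, b₊) = (n, n)` (`IsOfHodgeType.add_eq_zero_of_ne`) and then
`(a₋, b₋) = (b₊, a₊) = (n, n)` (`IsOfHodgeType.conjClass`, `IsOfHodgeType.eq_zero_of_ne`).

Sources: B. van Geemen, LNM 1594 (1994), 4.9–4.10, Lemma 5.2 (5)–(6) with proof; P. Deligne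
(notes by J. Milne), LNM 900 (1982), Prop. 4.4; C. Voisin, Hodge Theory I (2002), Cor. 6.12,
Cor. 6.14, §7.3.2. Everything from theorems of the tree; no named fact.
-/

noncomputable section

-- single-problem summit (Problem = Summit): the mandated namespace repeats `HodgeConjecture`.
set_option linter.dupNamespace false

open CategoryTheory Module
open scoped Matrix ComplexConjugate
open Literature.AlgebraicGeometry Literature.AlgebraicGeometry.Motives
  Literature.AlgebraicGeometry.HodgeTheory Literature.AlgebraicTopology.SingularHomology
  Literature.Geometry.Kaehler

namespace Summit.HodgeConjecture.HodgeConjecture.Theorems.WeilSixfoldsSqrtMinus7.HyperbolicEightfoldDescent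

section Typing

open Summit.HodgeConjecture.HodgeConjecture.Theorems.WeilTwelvefoldsSqrtMinus7.Negative

/-- **The Weil typing (the `K`-multiplicities `(n, n)` on `H^{1,0}`).** For a complex abelian
`2n`-fold `(A, φ)` with `φ ≫ φ = -7` carrying a non-zero rational `(n,n)`-class in its Weil span
`Eig((𝟙+φ)^*, (1+i√7)^{2n}) ⊔ Eig((𝟙+φ)^*, (1-i√7)^{2n})`, there are `n`-dimensional subspaces
`T₊ ⊆ V₊ ∩ H^{1,0}`, `T₋ ⊆ V₋ ∩ H^{1,0}` (`V± = ker(φ^* ∓ i√7)` on `H¹(A(ℂ); ℂ)`), i.e. `K = ℚ(√-7)`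
acts on `H^{1,0}` with multiplicities `(n, n)` — van Geemen's Definition 4.9, recovered from the
Weil witness: `φ^*` preserves Hodge types, so `V± = (V± ∩ H^{1,0}) ⊕ (V± ∩ H^{0,1})` with
dimensions `(a±, b±)`, `a± + b± = 2n`; the two typed eigenspaces of `(𝟙 + φ)^*` on `H^{2n}` are
the lines `⋀^{2n} V±` (`eigenspace_one_add_eq_span_cupPowOne`), of Hodge types `(a±, b±)`
(`isOfHodgeType_cupPowOne`); the components `c±` of the rational witness are conjugate
(`c₋ = conj c₊`, both non-zero), so a non-zero `(n,n)`-class `c = c₊ + c₋` forces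
`(a₊, b₊) = (n, n)` (three distinct types cannot sum, `eq_zero_of_isOfHodgeType_add`) and then
`(a₋, b₋) = (b₊, a₊) = (n, n)` (`eq_zero_of_isOfHodgeType_of_ne`).
[cite: vanGeemen1994HodgeAV, 4.9–4.10 and Lemma 5.2 (5)–(6) with proof] [cite: VoisinHodgeI2002, Cor. 6.12, Cor. 6.14 and §7.3.2] -/
theorem weilTyping :
    ∀ (n : ℕ) (A : AbelianVariety ℂ) (φ : A ⟶ A), 1 ≤ n → A.dim = 2 * n → φ ≫ φ = -((7 : ℤ) • 𝟙 A) →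
      (∃ c : complexBetti A.X (2 * n), c ≠ 0 ∧ IsRationalClass c ∧
        IsOfHodgeType (2 * n) A.X (2 * n) n n c ∧
        c ∈ Module.End.eigenspace (complexBetti.map (𝟙 A + φ).hom.hom.hom (2 * n)).hom
              ((1 + Complex.I * (Real.sqrt (7 : ℝ) : ℂ)) ^ (2 * n)) ⊔
            Module.End.eigenspace (complexBetti.map (𝟙 A + φ).hom.hom.hom (2 * n)).hom
              ((1 - Complex.I * (Real.sqrt (7 : ℝ) : ℂ)) ^ (2 * n))) →
    ∃ Tp Tm : Submodule ℂ (complexBetti A.X 1),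
      Module.finrank ℂ Tp = n ∧ Module.finrank ℂ Tm = n ∧
      (∀ x ∈ Tp, complexBetti.map φ.hom.hom.hom 1 x = (Complex.I * (Real.sqrt (7 : ℝ) : ℂ)) • x) ∧
      (∀ x ∈ Tm, complexBetti.map φ.hom.hom.hom 1 x = -(Complex.I * (Real.sqrt (7 : ℝ) : ℂ)) • x) ∧
      (∀ x ∈ Tp, IsOfHodgeType (2 * n) A.X 1 1 0 x) ∧
      (∀ x ∈ Tm, IsOfHodgeType (2 * n) A.X 1 1 0 x) := by
  intro n A φ hn hA hφ hwit
  classical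
  have hφ' : φ ≫ φ = -((7 : ℕ) • 𝟙 A) := by exact_mod_cast hφ
  have hX : IsSmoothProjective (2 * n) A.X := by
    have h := AbelianVariety.isSmoothProjective_holds (A := A)
    rwa [AbelianVariety.isSmoothProjective, hA] at h
  haveI := finite_complexBetti_abelianVariety A 1
  obtain ⟨Amod⟩ := (nonempty_hodgeModel_holds (n := 2 * n) (X := A.X)) hX
  set T := (complexBetti.map φ.hom.hom.hom 1).hom with hT
  set s : ℂ := Complex.I * ((Real.sqrt (7 : ℝ) : ℝ) : ℂ) with hs
  have hTT : ∀ y, T (T y) = -((7 : ℂ) • y) := fun y => by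
    have h := complexBetti_map_map_one_of_comp_self hφ' y
    exact_mod_cast h
  have hss : s * s = -7 := by
    rw [hs]
    have h := I_mul_sqrt7_mul_self
    push_cast at h
    exact h
  have hs0 : s ≠ 0 := mul_ne_zero Complex.I_ne_zero sqrt7_ne_zero
  -- the typed subspaces `H^{1,0}`, `H^{0,1}` of `H¹`
  set H10 : Submodule ℂ (complexBetti A.X 1) := (Amod.hodgePQ 1 1 0).comap (Amod.pullback 1).hom
    with hH10
  set H01 : Submodule ℂ (complexBetti A.X 1) := (Amod.hodgePQ 1 0 1).comap (Amod.pullback 1).hom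
    with hH01
  have m10 : ∀ x, x ∈ H10 ↔ IsOfHodgeType (2 * n) A.X 1 1 0 x := fun x =>
    (isOfHodgeType_iff_mem_hodgePQ hX Amod x).symm
  have m01 : ∀ x, x ∈ H01 ↔ IsOfHodgeType (2 * n) A.X 1 0 1 x := fun x =>
    (isOfHodgeType_iff_mem_hodgePQ hX Amod x).symm
  have hT10 : ∀ x ∈ H10, T x ∈ H10 := fun x hx =>
    (m10 _).2 (((m10 x).1 hx).map_of_isSmoothProjective hX hX φ.hom.hom.hom)
  have hT01 : ∀ x ∈ H01, T x ∈ H01 := fun x hx =>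
    (m01 _).2 (((m01 x).1 hx).map_of_isSmoothProjective hX hX φ.hom.hom.hom)
  have h1001 : H10 ⊓ H01 = ⊥ := by
    rw [Submodule.eq_bot_iff]
    rintro x ⟨hx1, hx0⟩
    exact IsOfHodgeType.eq_zero_of_ne hX ((m10 x).1 hx1) ((m01 x).1 hx0) (by decide)
  have hdec : ∀ x : complexBetti A.X 1, ∃ a ∈ H10, ∃ b ∈ H01, a + b = x := by
    intro x
    obtain ⟨z, hz, hzt⟩ := Amod.exists_sum_eq_of_hodgeDecomposition 1 x
    have h1 : Finset.HasAntidiagonal.antidiagonal 1 = {(0, 1), (1, 0)} := by decide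
    rw [h1, Finset.sum_pair (by decide)] at hz
    refine ⟨z (1, 0), hzt (1, 0) (by simp), z (0, 1), hzt (0, 1) (by simp), ?_⟩
    rw [add_comm]
    exact hz
  -- `V_μ = (V_μ ∩ H^{1,0}) ⊕ (V_μ ∩ H^{0,1})`
  have hproj : ∀ μ : ℂ, μ * μ = -7 → ∀ y, T (T y + μ • y) = μ • (T y + μ • y) := fun μ hμ y => by
    rw [map_add, map_smul, hTT, smul_add, smul_smul, hμ]
    module
  have hVsplit : ∀ μ : ℂ, μ * μ = -7 → μ ≠ 0 →
      (Module.End.eigenspace T μ ⊓ H10) ⊔ (Module.End.eigenspace T μ ⊓ H01) =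
        Module.End.eigenspace T μ := by
    intro μ hμ hμ0
    refine le_antisymm (sup_le inf_le_left inf_le_left) fun x hx => ?_
    have hx' := Module.End.mem_eigenspace_iff.1 hx
    obtain ⟨a, ha, b, hb, hab⟩ := hdec x
    have h2 : (2 * μ) ≠ 0 := mul_ne_zero two_ne_zero hμ0
    have hxa : x = (2 * μ)⁻¹ • (T a + μ • a) + (2 * μ)⁻¹ • (T b + μ • b) := by
      rw [← smul_add, show T a + μ • a + (T b + μ • b) = T (a + b) + μ • (a + b) by
        rw [map_add, smul_add]; abel, hab, hx', ← add_smul, ← two_mul, smul_smul,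
        inv_mul_cancel₀ h2, one_smul]
    rw [hxa]
    refine Submodule.add_mem _ (Submodule.mem_sup_left ⟨?_, ?_⟩) (Submodule.mem_sup_right ⟨?_, ?_⟩)
    · rw [SetLike.mem_coe, Module.End.mem_eigenspace_iff, map_smul, hproj μ hμ a, smul_comm]
    · exact Submodule.smul_mem _ _ (Submodule.add_mem _ (hT10 a ha) (Submodule.smul_mem _ _ ha))
    · rw [SetLike.mem_coe, Module.End.mem_eigenspace_iff, map_smul, hproj μ hμ b, smul_comm]
    · exact Submodule.smul_mem _ _ (Submodule.add_mem _ (hT01 b hb) (Submodule.smul_mem _ _ hb))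
  have hVdim : ∀ μ : ℂ, μ * μ = -7 → μ ≠ 0 →
      Module.finrank ℂ ↥(Module.End.eigenspace T μ ⊓ H10) +
        Module.finrank ℂ ↥(Module.End.eigenspace T μ ⊓ H01) =
        Module.finrank ℂ (Module.End.eigenspace T μ) := by
    intro μ hμ hμ0
    have h := Submodule.finrank_sup_add_finrank_inf_eq (Module.End.eigenspace T μ ⊓ H10)
      (Module.End.eigenspace T μ ⊓ H01)
    have h0 : (Module.End.eigenspace T μ ⊓ H10) ⊓ (Module.End.eigenspace T μ ⊓ H01) = ⊥ :=
      eq_bot_iff.2 (le_trans (inf_le_inf inf_le_right inf_le_right) h1001.le)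
    rw [hVsplit μ hμ hμ0, h0, finrank_bot, add_zero] at h
    exact h.symm
  -- `dim V± = 2n`
  have hVp : Module.finrank ℂ (Module.End.eigenspace T s) = 2 * n := by
    have h := two_mul_finrank_eigenspace_eq (by norm_num : 0 < 7) hφ'
    rw [abelianVarietyCohomologyExteriorH1_holds.finrank_one, hA] at h
    change 2 * Module.finrank ℂ (Module.End.eigenspace T s) = _ at h
    omega
  have hVm : Module.finrank ℂ (Module.End.eigenspace T (-s)) = 2 * n := by
    have h := finrank_eigenspace_eq_finrank_eigenspace_neg (by norm_num : 0 < 7) hφ'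
    change Module.finrank ℂ (Module.End.eigenspace T s) =
      Module.finrank ℂ (Module.End.eigenspace T (-s)) at h
    rw [← h, hVp]
  -- typed eigenbases
  have hbasis : ∀ μ : ℂ, μ * μ = -7 → μ ≠ 0 → Module.finrank ℂ (Module.End.eigenspace T μ) = 2 * n →
      ∃ (e : Fin (2 * n) → complexBetti A.X 1) (t : Fin (2 * n) → Bool), LinearIndependent ℂ e ∧
        (∀ i, e i ∈ Module.End.eigenspace T μ) ∧ (∀ i, t i = true → e i ∈ H10) ∧
        (∀ i, t i = false → e i ∈ H01) ∧
        (Finset.univ.filter fun i => t i = true).card = Module.finrank ℂ ↥(Module.End.eigenspace T μ ⊓ H10) := by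
    intro μ hμ hμ0 hdim
    set P1 : Submodule ℂ (complexBetti A.X 1) := Module.End.eigenspace T μ ⊓ H10 with hP1
    set P0 : Submodule ℂ (complexBetti A.X 1) := Module.End.eigenspace T μ ⊓ H01 with hP0
    let c1 := Module.finBasis ℂ P1
    let c0 := Module.finBasis ℂ P0
    have hab : Module.finrank ℂ P1 + Module.finrank ℂ P0 = 2 * n := by rw [hVdim μ hμ hμ0, hdim]
    let w : Fin (Module.finrank ℂ P1) ⊕ Fin (Module.finrank ℂ P0) → complexBetti A.X 1 :=
      Sum.elim (fun i => (c1 i : complexBetti A.X 1)) (fun i => (c0 i : complexBetti A.X 1))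
    have hw1 : LinearIndependent ℂ fun i => (c1 i : complexBetti A.X 1) :=
      c1.linearIndependent.map' P1.subtype (Submodule.ker_subtype P1)
    have hw0 : LinearIndependent ℂ fun i => (c0 i : complexBetti A.X 1) :=
      c0.linearIndependent.map' P0.subtype (Submodule.ker_subtype P0)
    have hdisjw : Disjoint (Submodule.span ℂ (Set.range fun i => (c1 i : complexBetti A.X 1)))
        (Submodule.span ℂ (Set.range fun i => (c0 i : complexBetti A.X 1))) := by
      refine Disjoint.mono (Submodule.span_le.2 ?_) (Submodule.span_le.2 ?_)
        (disjoint_iff.2 (eq_bot_iff.2 (le_trans (inf_le_inf inf_le_right inf_le_right) h1001.le)) :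
          Disjoint P1 P0)
      · rintro _ ⟨i, rfl⟩
        exact (c1 i).2
      · rintro _ ⟨i, rfl⟩
        exact (c0 i).2
    have hw : LinearIndependent ℂ w := hw1.sum_type hw0 hdisjw
    let σ : Fin (2 * n) ≃ Fin (Module.finrank ℂ P1) ⊕ Fin (Module.finrank ℂ P0) :=
      (finCongr hab.symm).trans finSumFinEquiv.symm
    refine ⟨w ∘ σ, fun i => (σ i).isLeft, hw.comp σ σ.injective, ?_, ?_, ?_, ?_⟩
    · intro i
      change w (σ i) ∈ _
      rcases σ i with j | j
      · exact (c1 j).2.1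
      · exact (c0 j).2.1
    · intro i hi
      dsimp only at hi
      change w (σ i) ∈ H10
      generalize σ i = x at hi ⊢
      rcases x with j | j
      · exact (c1 j).2.2
      · simp at hi
    · intro i hi
      dsimp only at hi
      change w (σ i) ∈ H01
      generalize σ i = x at hi ⊢
      rcases x with j | j
      · simp at hi
      · exact (c0 j).2.2
    · rw [Finset.card_filter, Equiv.sum_comp σ (fun x => if x.isLeft = true then 1 else 0),
        Fintype.sum_sum_type]
      simp
  obtain ⟨eP, tP, hePi, hePV, heP1, heP0, hcardP⟩ := hbasis s hss hs0 hVp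
  obtain ⟨eM, tM, heMi, heMV, heM1, heM0, hcardM⟩ :=
    hbasis (-s) (by rw [neg_mul_neg, hss]) (neg_ne_zero.2 hs0) hVm
  -- counts
  have hcountP : (∑ i, if tP i = true then 1 else 0) + (∑ i, if tP i = true then 0 else 1) = 2 * n := by
    rw [← Finset.sum_add_distrib]
    rw [Finset.sum_congr rfl (fun i _ => show ((if tP i = true then 1 else 0) + if tP i = true then 0 else 1) = 1 by
      cases tP i <;> simp)]
    simp
  have hcountM : (∑ i, if tM i = true then 1 else 0) + (∑ i, if tM i = true then 0 else 1) = 2 * n := by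
    rw [← Finset.sum_add_distrib]
    rw [Finset.sum_congr rfl (fun i _ => show ((if tM i = true then 1 else 0) + if tM i = true then 0 else 1) = 1 by
      cases tM i <;> simp)]
    simp
  -- the two Weil lines and their Hodge types
  have hb₁ : Module.finrank ℂ (complexBetti A.X 1) = 2 * n + 2 * n := by
    rw [abelianVarietyCohomologyExteriorH1_holds.finrank_one, hA]; ring
  set Lop := (complexBetti.map (𝟙 A + φ).hom.hom.hom (2 * n)).hom with hLop
  have hEp : Module.End.eigenspace Lop ((1 + s) ^ (2 * n)) =
      ℂ ∙ cupPowOne ℂ (ComplexPoints A.X) (2 * n) eP :=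
    eigenspace_one_add_eq_span_cupPowOne A n φ hb₁ _ (Or.inl rfl) eP eM hePi heMi hePV heMV
  have hEm : Module.End.eigenspace Lop ((1 - s) ^ (2 * n)) =
      ℂ ∙ cupPowOne ℂ (ComplexPoints A.X) (2 * n) eM := by
    rw [sub_eq_add_neg]
    exact eigenspace_one_add_eq_span_cupPowOne A n φ hb₁ _ (Or.inr rfl) eM eP heMi hePi heMV
      (fun i => by rw [neg_neg]; exact hePV i)
  have htyped : ∀ (e : Fin (2 * n) → complexBetti A.X 1) (t : Fin (2 * n) → Bool),
      (∀ i, t i = true → e i ∈ H10) → (∀ i, t i = false → e i ∈ H01) →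
      ∀ i, IsOfHodgeType (2 * n) A.X 1 (if t i = true then 1 else 0) (if t i = true then 0 else 1) (e i) := by
    intro e t h1 h0 i
    cases ht : t i
    · simpa using (m01 _).1 (h0 i ht)
    · simpa using (m10 _).1 (h1 i ht)
  have htP := isOfHodgeType_cupPowOne hX (by omega : 0 < 2 * n) eP (fun i => if tP i = true then 1 else 0)
    (fun i => if tP i = true then 0 else 1) (htyped eP tP heP1 heP0)
  have htM := isOfHodgeType_cupPowOne hX (by omega : 0 < 2 * n) eM (fun i => if tM i = true then 1 else 0)
    (fun i => if tM i = true then 0 else 1) (htyped eM tM heM1 heM0)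
  rw [Finset.card_filter] at hcardP hcardM
  generalize haP : (∑ i, if tP i = true then 1 else 0) = aP at htP hcountP hcardP
  generalize hbP : (∑ i, if tP i = true then 0 else 1) = bP at htP hcountP
  generalize haM : (∑ i, if tM i = true then 1 else 0) = aM at htM hcountM hcardM
  generalize hbM : (∑ i, if tM i = true then 0 else 1) = bM at htM hcountM
  -- the Weil witness and its conjugate components
  obtain ⟨c, hc0, hcr, hcH, hcmem⟩ := hwit
  obtain ⟨cp, hcp, cm, hcm, hcsum⟩ := Submodule.mem_sup.1 hcmem
  change cp ∈ Module.End.eigenspace Lop ((1 + s) ^ (2 * n)) at hcp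
  change cm ∈ Module.End.eigenspace Lop ((1 - s) ^ (2 * n)) at hcm
  have hcp' : conjClass (ComplexPoints A.X) (2 * n) cp ∈ Module.End.eigenspace Lop ((1 - s) ^ (2 * n)) := by
    have h := conjClass_mem_eigenspace_map _ hcp
    rwa [conj_one_add_I_sqrt7_pow] at h
  have hcm' : conjClass (ComplexPoints A.X) (2 * n) cm ∈ Module.End.eigenspace Lop ((1 + s) ^ (2 * n)) := by
    have h := conjClass_mem_eigenspace_map _ hcm
    rwa [conj_one_sub_I_sqrt7_pow] at h
  have hne : (1 + s) ^ (2 * n) ≠ (1 - s) ^ (2 * n) := one_add_I_sqrt7_pow_ne (2 * n) (by omega)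
  have hcm_eq : cm = conjClass (ComplexPoints A.X) (2 * n) cp := by
    have h1 : conjClass (ComplexPoints A.X) (2 * n) c = c := hcr.conjClass_eq
    rw [← hcsum, conjClass_add] at h1
    -- `cp - conj cm = conj cp - cm` lies in both eigenspaces
    have h2 : cp - conjClass (ComplexPoints A.X) (2 * n) cm =
        conjClass (ComplexPoints A.X) (2 * n) cp - cm := by
      have h3 : conjClass (ComplexPoints A.X) (2 * n) cp + conjClass (ComplexPoints A.X) (2 * n) cm =
        cp + cm := h1
      calc cp - conjClass (ComplexPoints A.X) (2 * n) cm
          = (cp + cm) - conjClass (ComplexPoints A.X) (2 * n) cm - cm := by abel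
        _ = conjClass (ComplexPoints A.X) (2 * n) cp - cm := by rw [← h3]; abel
    have hinp : cp - conjClass (ComplexPoints A.X) (2 * n) cm ∈ Module.End.eigenspace Lop ((1 + s) ^ (2 * n)) :=
      Submodule.sub_mem _ hcp hcm'
    have hinm : cp - conjClass (ComplexPoints A.X) (2 * n) cm ∈ Module.End.eigenspace Lop ((1 - s) ^ (2 * n)) := by
      rw [h2]
      exact Submodule.sub_mem _ hcp' hcm
    have hz := eq_zero_of_mem_eigenspace_of_mem_eigenspace Lop hne hinp hinm
    rw [h2, sub_eq_zero] at hz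
    exact hz.symm
  have hcp0 : cp ≠ 0 := fun h0 => hc0 (by rw [← hcsum, hcm_eq, h0, conjClass_zero, add_zero])
  have hcm0 : cm ≠ 0 := by
    rw [hcm_eq]
    exact conjClass_ne_zero hcp0
  -- Hodge types of the components
  have hcp_mem : cp ∈ ℂ ∙ cupPowOne ℂ (ComplexPoints A.X) (2 * n) eP := by rw [← hEp]; exact hcp
  have hcm_mem : cm ∈ ℂ ∙ cupPowOne ℂ (ComplexPoints A.X) (2 * n) eM := by rw [← hEm]; exact hcm
  obtain ⟨tp, htp⟩ := Submodule.mem_span_singleton.1 hcp_mem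
  obtain ⟨tm, htm⟩ := Submodule.mem_span_singleton.1 hcm_mem
  have hcpT : IsOfHodgeType (2 * n) A.X (2 * n) aP bP cp := by rw [← htp]; exact htP.smul tp
  have hcmT₁ : IsOfHodgeType (2 * n) A.X (2 * n) bP aP cm := by rw [hcm_eq]; exact hcpT.conjClass hX
  have hcmT₂ : IsOfHodgeType (2 * n) A.X (2 * n) aM bM cm := by rw [← htm]; exact htM.smul tm
  -- `aP = n`
  have haPn : aP = n := by
    by_contra hne'
    have hne₁ : (n, n) ≠ (aP, bP) := fun h => hne' (Prod.mk.inj h).1.symm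
    have hne₂ : (n, n) ≠ (bP, aP) := by
      intro h
      have h' : n = bP := (Prod.mk.inj h).1
      omega
    have hcH' : IsOfHodgeType (2 * n) A.X (2 * n) n n (cp + cm) := by rw [hcsum]; exact hcH
    refine hc0 ?_
    rw [← hcsum]
    exact IsOfHodgeType.add_eq_zero_of_ne hX hcpT hcmT₁ hcH' hcountP (by omega) (by omega) hne₁ hne₂
  have hbPn : bP = n := by omega
  -- `aM = n`
  have haMn : aM = n := by
    by_contra hne'
    have h12 : (aM, bM) ≠ (bP, aP) := by
      rw [haPn, hbPn]
      intro h
      exact hne' (Prod.mk.inj h).1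
    exact hcm0 (IsOfHodgeType.eq_zero_of_ne hX hcmT₂ hcmT₁ h12)
  -- the typed pieces
  refine ⟨Module.End.eigenspace T s ⊓ H10, Module.End.eigenspace T (-s) ⊓ H10, ?_, ?_, ?_, ?_, ?_, ?_⟩
  · rw [← hcardP, haPn]
  · rw [← hcardM, haMn]
  · rintro x ⟨hx, -⟩
    exact Module.End.mem_eigenspace_iff.1 hx
  · rintro x ⟨hx, -⟩
    exact Module.End.mem_eigenspace_iff.1 hx
  · rintro x ⟨-, hx⟩
    exact (m10 x).1 hx
  · rintro x ⟨-, hx⟩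
    exact (m10 x).1 hx

end Typing

end Summit.HodgeConjecture.HodgeConjecture.Theorems.WeilSixfoldsSqrtMinus7.HyperbolicEightfoldDescent

end
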